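import Literature.NumberTheory.LFunctions.ConreyIwaniec2002CircleMethodKloostermanStep
import Literature.NumberTheory.LFunctions.IncompleteKloostermanSmooth
import HarnessLib

/-!
# Conrey–Iwaniec (2002), proof of Theorem 4.1: the contribution of one modulus `c`

B. Conrey, H. Iwaniec, *Spacing of zeros of Hecke `L`-functions and the class number problem*,
Acta Arith. 103 (2002) 259–312, §4, proof of Theorem 4.1 [held text `paper:arxiv-math_0111012`,
p0010:L75–p0011:L60]. After the dissection (4.10)–(4.13), the modulus `c ≤ C` contributes
`∫_{-1/cC}^{1/cC} e(αh)V_c(α)dα`; the expansion of `V_c(α)` ((4.3), (4.14)) gives the leading term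
`r_c(h)p(c)²∫_{-1/cC}^{1/cC} e(αh)|ĝ(α)|²dα` plus an error which, integrated with (4.8)–(4.9), is
`≪ A²B²C(h,c)^{1/2}c^{-1/2}τ(c)log²C` per modulus ("To estimate `R` we apply (4.8) and (4.9)"), and
"in the leading term we extend the integration to all `α ∈ ℝ` at the cost of an error term which
is already present. Then … by the Plancherel theorem `∫e(αh)|ĝ(α)|²dα = ∫g(x+h)ḡ(x)dx`."

This file carries out exactly this per-modulus step, for the assembly of Theorem 4.1 (registered
stub S3b3 `stub_circle_assembly` of SKELETON S3, cell `landau-siegel/ls-inputs`, line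
`theta-circle-method`): `norm_modulus_sub_main_le` bounds, for `1 ≤ c ≤ C' = ⌊C⌋`,
`‖Σ_{C' < d ≤ c+C', (c,d)=1} ∫₀^{1/cd} (F(a_d/c − α) + F(−(a_d/c − α)))dα − p(c)²r_c(h)∫g₁(x+h)g₂(x)dx‖`
by `(W_c/c)·(2AMc₁I₂ + 2M²/(C'+1) + 2A²C'c₁²I₃) + A²c₁²I₃(C'+1)(h,c)/c`
(`W_c = K₀τ(c)(h,c)^{1/2}c^{1/2}(1+log c)`, `M = ABC·K₅₄²`, `I₂ = ∫(1+|u|)^{-2}`, `I₃ = ∫(1+|u|)^{-3}`).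

## References

* [ConreyIwaniec2002] B. Conrey, H. Iwaniec, Acta Arith. 103 (2002) 259–312, arXiv:math/0111012:
  §4 (4.11)–(4.17), proof of Theorem 4.1.
-/

noncomputable section

open scoped FourierTransform ComplexConjugate
open Complex MeasureTheory Set Finset

namespace Literature.NumberTheory.LFunctions

namespace ConreyIwaniec2002

namespace CircleMethod

open Literature.NumberTheory.Sieve (ramanujanSum ramanujanSum_neg)
open Literature.NumberTheory.LFunctions.MatomakiMerikoski (norm_ramanujanSum_le_gcd)

/-! ### The interval `I(α)` of (4.13) -/

/-- For `α > 0`: `{C' < d ≤ c + C' : (c,d) = 1, α ≤ 1/(cd)} = {C' < d ≤ min(c + C', ⌊1/(cα)⌋) : (c,d)=1}`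
— "`I = (C, min{c + C, 1/(|α|c)}]`" (4.13). [cite: ConreyIwaniec2002, §4 (4.13)] -/
theorem filter_le_inv_eq {c C' : ℕ} (hc : 1 ≤ c) {α : ℝ} (hα : 0 < α) :
    ((Finset.Ioc C' (c + C')).filter (fun d ↦ Nat.Coprime c d)).filter
        (fun d : ℕ ↦ α ≤ 1 / ((c : ℝ) * (d : ℝ))) =
      (Finset.Ioc C' (min (c + C') ⌊1 / ((c : ℝ) * α)⌋₊)).filter (fun d ↦ Nat.Coprime c d) := by
  have hc' : (0 : ℝ) < c := by exact_mod_cast hc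
  ext d
  simp only [Finset.mem_filter, Finset.mem_Ioc, le_min_iff]
  constructor
  · rintro ⟨⟨⟨h1, h2⟩, h3⟩, h4⟩
    refine ⟨⟨h1, h2, ?_⟩, h3⟩
    rw [Nat.le_floor_iff (by positivity)]
    have hd : (0 : ℝ) < d := by exact_mod_cast (lt_of_le_of_lt (Nat.zero_le _) h1)
    rw [le_div_iff₀ (by positivity)] at h4
    rw [le_div_iff₀ (by positivity)]
    linarith [mul_comm α ((c : ℝ) * d)]
  · rintro ⟨⟨h1, h2, h3⟩, h4⟩
    refine ⟨⟨⟨h1, h2⟩, h4⟩, ?_⟩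
    rw [Nat.le_floor_iff (by positivity)] at h3
    have hd : (0 : ℝ) < d := by exact_mod_cast (lt_of_le_of_lt (Nat.zero_le _) h1)
    rw [le_div_iff₀ (by positivity)] at h3
    rw [le_div_iff₀ (by positivity)]
    nlinarith

/-- The truncation indicator: for `0 < α`, if `min(c + C', ⌊1/(cα)⌋) < C' + c` then
`1 < αc(c + C')` ("`I = (C, 1/|α|c]` is shorter than `c` if `c^{-1}(c+C)^{-1} < |α|`"), so
`[y < C' + c] ≤ αc(c + C')`. [cite: ConreyIwaniec2002, §4 (4.13)] -/
theorem ite_lt_le_mul {c C' : ℕ} (hc : 1 ≤ c) {α : ℝ} (hα : 0 < α) :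
    (if min (c + C') ⌊1 / ((c : ℝ) * α)⌋₊ < C' + c then (1 : ℝ) else 0) ≤
      α * c * ((c : ℝ) + C') := by
  have hc' : (0 : ℝ) < c := by exact_mod_cast hc
  split_ifs with hlt
  · have hfl : ⌊1 / ((c : ℝ) * α)⌋₊ < c + C' := by
      rcases min_lt_iff.mp hlt with h | h <;> omega
    rw [Nat.floor_lt (by positivity)] at hfl
    rw [div_lt_iff₀ (by positivity)] at hfl
    push_cast at hfl
    nlinarith
  · positivity

/-! ### The pointwise estimate at one `α ∈ (0, 1/(c(C'+1))]` -/

/-- `(−h, c) = (h, c) = (h, c)` for the two signs. [folklore] -/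
private theorem int_gcd_neg_natCast (h c : ℕ) : Int.gcd (-(h : ℤ)) c = Nat.gcd h c := by
  simp [Int.gcd]

/-- `(h, c)` over `ℤ` and over `ℕ` agree. [folklore] -/
private theorem int_gcd_natCast (h c : ℕ) : Int.gcd (h : ℤ) c = Nat.gcd h c := by
  simp [Int.gcd]

/-- **Pointwise estimate of `V_c(α) + V_c(−α)` against its leading term**, `0 < α ≤ 1/(c(C'+1))`:
with `I(α)` the interval (4.13), `F(θ) = e(−hθ)S₁(θ)S̄₂(θ)`, `Ĝ(α) = ĝ₁(α)conj((ḡ₂)^(α))`,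
`‖Σ_{d ∈ I(α)} (F(a_d/c − α) + F(−(a_d/c − α))) − p(c)²r_c(h)(Ĝ(α)e(hα) + Ĝ(−α)e(−hα))‖ ≤
(W_c/c)·(AM(|ĝ₁(α)| + |(ḡ₂)^(α)| + |ĝ₁(−α)| + |(ḡ₂)^(−α)|) + 2cM² +
A²(c + C')(|α||ĝ₁(α)(ḡ₂)^(α)| + |−α||ĝ₁(−α)(ḡ₂)^(−α)|))` — print's
`V_c(α) = |ĝ(α)p(c)|²{Σ*_{C<d≤c+C}e(−ah/c) + O(|α|cC(h,c)^{1/2}c^{1/2}τ(c)log C)} + O(A²(h,c)^{1/2}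
c^{3/2}τ(c)(log C)(|ĝ(α)| + Σ τ(m)|ĝ_m(α)|)(Σ τ(m)|ĝ_m(α)|))`, both signs of `α` added.
[cite: ConreyIwaniec2002, §4, proof of Theorem 4.1 ((4.13)–(4.15))] -/
theorem norm_pointwise_sub_main_le
    {A B K₀ : ℝ} {q : ℕ} {lam : ℕ → ℂ} {kf : ℕ → ℕ → ℝ → ℂ} {p : ℕ → ℝ} {u : ℕ → ℤ → ℂ}
    {φ : ℕ → ℕ → ℂ} {l : ℕ → ℕ → ℤ}
    (hV : IsVoronoiDatum A lam kf p u φ l) (hK : KernelFourierBound q B kf)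
    (hKl : IncompleteKloostermanBound K₀) (hK₀ : 0 ≤ K₀)
    {X : ℝ} (hX : 1 / 2 ≤ X) {g₁ g₂ : ℝ → ℂ} (hg₁ : IsBumpOn X g₁) (hg₂ : IsBumpOn X g₂)
    (h : ℕ) {C' c : ℕ} (hc : 1 ≤ c) (hcC' : c ≤ C') (hC'C : (C' : ℝ) ≤ 2 * Real.sqrt (q * X))
    (hCC' : 2 * Real.sqrt (q * X) ≤ C' + 1)
    {α : ℝ} (hα0 : 0 < α) (hαT : α ≤ 1 / ((c : ℝ) * (C' + 1)))
    (F : ℝ → ℂ)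
    (hF : ∀ θ : ℝ, F θ = (𝐞 (-(h * θ)) : ℂ) *
        ((∑ n ∈ Finset.Icc 1 ⌊2 * X⌋₊, lam n * g₁ n * (𝐞 (n * θ) : ℂ)) *
          conj (∑ n ∈ Finset.Icc 1 ⌊2 * X⌋₊, lam n * conj (g₂ n) * (𝐞 (n * θ) : ℂ)))) :
    ‖(∑ d ∈ ((Finset.Ioc C' (c + C')).filter (fun d ↦ Nat.Coprime c d)).filter
          (fun d : ℕ ↦ α ≤ 1 / ((c : ℝ) * (d : ℝ))),
        (F (((((d : ZMod c)⁻¹).val : ℝ)) / c - α) + F (-(((((d : ZMod c)⁻¹).val : ℝ)) / c - α)))) -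
      (p c : ℂ) ^ 2 * ramanujanSum c h *
        (𝓕 g₁ α * conj (𝓕 (fun x ↦ conj (g₂ x)) α) * (𝐞 (h * α) : ℂ) +
          𝓕 g₁ (-α) * conj (𝓕 (fun x ↦ conj (g₂ x)) (-α)) * (𝐞 (-(h * α)) : ℂ))‖ ≤
      (K₀ * (Nat.divisors c).card * Real.sqrt (Nat.gcd h c) * Real.sqrt c * (1 + Real.log c)) / c *
        (A * (A * B * (2 * Real.sqrt (q * X)) * (∑' n : ℕ, (n : ℝ) ^ (-(5 / 4 : ℝ))) ^ 2) *
            (‖𝓕 g₁ α‖ + ‖𝓕 (fun x ↦ conj (g₂ x)) α‖ +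
              (‖𝓕 g₁ (-α)‖ + ‖𝓕 (fun x ↦ conj (g₂ x)) (-α)‖)) +
          2 * c * (A * B * (2 * Real.sqrt (q * X)) * (∑' n : ℕ, (n : ℝ) ^ (-(5 / 4 : ℝ))) ^ 2) ^ 2 +
          A ^ 2 * ((c : ℝ) + C') *
            (|α| * (‖𝓕 g₁ α‖ * ‖𝓕 (fun x ↦ conj (g₂ x)) α‖) +
              |(-α)| * (‖𝓕 g₁ (-α)‖ * ‖𝓕 (fun x ↦ conj (g₂ x)) (-α)‖))) := by
  classical
  -- abbreviations
  set C : ℝ := 2 * Real.sqrt (q * X) with hCdef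
  set M : ℝ := A * B * C * (∑' n : ℕ, (n : ℝ) ^ (-(5 / 4 : ℝ))) ^ 2 with hM
  set W : ℝ := K₀ * (Nat.divisors c).card * Real.sqrt (Nat.gcd h c) * Real.sqrt c *
    (1 + Real.log c) with hW
  set y : ℕ := min (c + C') ⌊1 / ((c : ℝ) * α)⌋₊ with hy
  set I : Finset ℕ := (Finset.Ioc C' y).filter (fun d ↦ Nat.Coprime c d) with hI
  set G : ℝ → ℂ := fun β ↦ 𝓕 g₁ β * conj (𝓕 (fun x ↦ conj (g₂ x)) β) with hG
  have hc' : (0 : ℝ) < c := by exact_mod_cast hc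
  have hcC : (c : ℝ) ≤ C := le_trans (by exact_mod_cast hcC') hC'C
  -- `|α| ≤ 1/(cC)` since `α ≤ 1/(c(C'+1))` and `C ≤ C' + 1`
  have hCpos : 0 < C := lt_of_lt_of_le hc' hcC
  have hαC : |α| ≤ 1 / (c * C) := by
    rw [abs_of_pos hα0]
    refine hαT.trans ?_
    exact one_div_le_one_div_of_le (by positivity) (by gcongr)
  have hαC' : |(-α)| ≤ 1 / (c * C) := by rwa [abs_neg]
  -- the interval `I(α)`
  have hIeq : ((Finset.Ioc C' (c + C')).filter (fun d ↦ Nat.Coprime c d)).filter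
      (fun d : ℕ ↦ α ≤ 1 / ((c : ℝ) * (d : ℝ))) = I := by
    rw [hI, hy]; exact filter_le_inv_eq hc hα0
  have hC'y : C' ≤ y := by
    rw [hy, le_min_iff]
    refine ⟨by omega, ?_⟩
    rw [Nat.le_floor_iff (by positivity), le_div_iff₀ (by positivity)]
    have h1 : α * ((c : ℝ) * (C' + 1)) ≤ 1 := by
      rw [le_div_iff₀ (by positivity)] at hαT; exact hαT
    nlinarith
  have hyle : y ≤ C' + c := by rw [hy]; omega
  -- data at level `c`
  obtain ⟨hp0, hpA, -, -⟩ := hV c hc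
  have hA0 : 0 ≤ A := by
    have := hp0.trans hpA
    rw [le_div_iff₀ hc'] at this
    nlinarith
  -- the two Kloosterman steps (s = 1 and s = -1)
  set Rp : ℂ := ∑ d ∈ I, (𝐞 (((-(h : ℤ)) * (((d : ZMod c)⁻¹).val : ℤ) : ℤ) / c) : ℂ) with hRp
  set Rm : ℂ := ∑ d ∈ I, (𝐞 (((h : ℤ) * (((d : ZMod c)⁻¹).val : ℤ) : ℤ) / c) : ℂ) with hRm
  set Sp : ℂ := ∑ d ∈ I, F (((((d : ZMod c)⁻¹).val : ℝ)) / c - α) with hSp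
  set Sm : ℂ := ∑ d ∈ I, F (-(((((d : ZMod c)⁻¹).val : ℝ)) / c - α)) with hSm
  have hplus : ‖Sp - (𝐞 (h * α) : ℂ) * ((p c : ℂ) ^ 2 * G α) * Rp‖ ≤
      W * ((A / c) * (‖𝓕 g₁ α‖ + ‖𝓕 (fun x ↦ conj (g₂ x)) α‖) * M + M ^ 2) := by
    have := norm_sum_shifted_sub_main_le hV hK hKl hX hg₁ hg₂ h hc hcC hαC (s := 1)
      (Or.inl rfl) hC'y hyle F hF
    simpa only [Int.cast_one, one_mul] using this
  have hminus : ‖Sm - (𝐞 (-(h * α)) : ℂ) * ((p c : ℂ) ^ 2 * G (-α)) * Rm‖ ≤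
      W * ((A / c) * (‖𝓕 g₁ (-α)‖ + ‖𝓕 (fun x ↦ conj (g₂ x)) (-α)‖) * M + M ^ 2) := by
    have := norm_sum_shifted_sub_main_le hV hK hKl hX hg₁ hg₂ h hc hcC hαC (s := -1)
      (Or.inr rfl) hC'y hyle F hF
    simpa only [Int.cast_neg, Int.cast_one, neg_one_mul, one_mul, neg_neg, neg_mul] using this
  -- the two leading `d`-sums against the Ramanujan sum
  have hR1 : ‖Rp - ramanujanSum c h‖ ≤ (if y < C' + c then (1 : ℝ) else 0) * W := by
    have := norm_sum_fourierChar_inv_sub_ramanujanSum_le hKl hc (-(h : ℤ)) hC'y hyle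
    rw [int_gcd_neg_natCast, ramanujanSum_neg] at this
    exact this
  have hR2 : ‖Rm - ramanujanSum c h‖ ≤ (if y < C' + c then (1 : ℝ) else 0) * W := by
    have := norm_sum_fourierChar_inv_sub_ramanujanSum_le hKl hc (h : ℤ) hC'y hyle
    rw [int_gcd_natCast] at this
    exact this
  -- algebraic splitting
  rw [hIeq, Finset.sum_add_distrib]
  set r : ℂ := ramanujanSum c h with hr
  set ep : ℂ := (𝐞 (h * α) : ℂ) with hep
  set em : ℂ := (𝐞 (-(h * α)) : ℂ) with hem
  set P2 : ℂ := (p c : ℂ) ^ 2 with hP2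
  have hsplit : Sp + Sm - P2 * r * (G α * ep + G (-α) * em) =
      (Sp - ep * (P2 * G α) * Rp) + (Sm - em * (P2 * G (-α)) * Rm) +
        ep * (P2 * G α * (Rp - r)) + em * (P2 * G (-α) * (Rm - r)) := by ring
  -- norms of the elementary factors
  have hep1 : ‖ep‖ = 1 := Circle.norm_coe _
  have hem1 : ‖em‖ = 1 := Circle.norm_coe _
  have hP2n : ‖P2‖ = p c ^ 2 := by
    rw [hP2, norm_pow, Complex.norm_real, Real.norm_of_nonneg hp0]
  have hGn : ∀ β : ℝ, ‖G β‖ = ‖𝓕 g₁ β‖ * ‖𝓕 (fun x ↦ conj (g₂ x)) β‖ := fun β ↦ by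
    rw [hG, norm_mul, Complex.norm_conj]
  have hW0 : 0 ≤ W := by rw [hW]; positivity
  have hind : (if y < C' + c then (1 : ℝ) else 0) ≤ α * c * ((c : ℝ) + C') := by
    rw [hy]; exact ite_lt_le_mul hc hα0
  have hp2 : p c ^ 2 ≤ (A / c) ^ 2 := pow_le_pow_left₀ hp0 hpA 2
  -- the third and fourth pieces
  have h3 : ‖ep * (P2 * G α * (Rp - r))‖ ≤
      W / c * (A ^ 2 * ((c : ℝ) + C') * (|α| * (‖𝓕 g₁ α‖ * ‖𝓕 (fun x ↦ conj (g₂ x)) α‖))) := by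
    rw [norm_mul, hep1, one_mul, norm_mul, norm_mul, hP2n, hGn, abs_of_pos hα0]
    have hG0 : 0 ≤ ‖𝓕 g₁ α‖ * ‖𝓕 (fun x ↦ conj (g₂ x)) α‖ := by positivity
    calc p c ^ 2 * (‖𝓕 g₁ α‖ * ‖𝓕 (fun x ↦ conj (g₂ x)) α‖) * ‖Rp - r‖
        ≤ (A / c) ^ 2 * (‖𝓕 g₁ α‖ * ‖𝓕 (fun x ↦ conj (g₂ x)) α‖) *
            ((α * c * ((c : ℝ) + C')) * W) := by
          refine mul_le_mul (mul_le_mul_of_nonneg_right hp2 hG0) (hR1.trans ?_) (norm_nonneg _)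
            (by positivity)
          exact mul_le_mul_of_nonneg_right hind hW0
      _ = W / c * (A ^ 2 * ((c : ℝ) + C') * (α * (‖𝓕 g₁ α‖ * ‖𝓕 (fun x ↦ conj (g₂ x)) α‖))) := by
          field_simp
  have h4 : ‖em * (P2 * G (-α) * (Rm - r))‖ ≤
      W / c * (A ^ 2 * ((c : ℝ) + C') *
        (|(-α)| * (‖𝓕 g₁ (-α)‖ * ‖𝓕 (fun x ↦ conj (g₂ x)) (-α)‖))) := by
    rw [norm_mul, hem1, one_mul, norm_mul, norm_mul, hP2n, hGn, abs_neg, abs_of_pos hα0]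
    have hG0 : 0 ≤ ‖𝓕 g₁ (-α)‖ * ‖𝓕 (fun x ↦ conj (g₂ x)) (-α)‖ := by positivity
    calc p c ^ 2 * (‖𝓕 g₁ (-α)‖ * ‖𝓕 (fun x ↦ conj (g₂ x)) (-α)‖) * ‖Rm - r‖
        ≤ (A / c) ^ 2 * (‖𝓕 g₁ (-α)‖ * ‖𝓕 (fun x ↦ conj (g₂ x)) (-α)‖) *
            ((α * c * ((c : ℝ) + C')) * W) := by
          refine mul_le_mul (mul_le_mul_of_nonneg_right hp2 hG0) (hR2.trans ?_) (norm_nonneg _)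
            (by positivity)
          exact mul_le_mul_of_nonneg_right hind hW0
      _ = W / c * (A ^ 2 * ((c : ℝ) + C') *
          (α * (‖𝓕 g₁ (-α)‖ * ‖𝓕 (fun x ↦ conj (g₂ x)) (-α)‖))) := by
          field_simp
  -- assemble
  rw [hsplit]
  calc ‖(Sp - ep * (P2 * G α) * Rp) + (Sm - em * (P2 * G (-α)) * Rm) +
        ep * (P2 * G α * (Rp - r)) + em * (P2 * G (-α) * (Rm - r))‖
      ≤ ‖Sp - ep * (P2 * G α) * Rp‖ + ‖Sm - em * (P2 * G (-α)) * Rm‖ +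
        ‖ep * (P2 * G α * (Rp - r))‖ + ‖em * (P2 * G (-α) * (Rm - r))‖ := norm_add₄_le
    _ ≤ W * ((A / c) * (‖𝓕 g₁ α‖ + ‖𝓕 (fun x ↦ conj (g₂ x)) α‖) * M + M ^ 2) +
        W * ((A / c) * (‖𝓕 g₁ (-α)‖ + ‖𝓕 (fun x ↦ conj (g₂ x)) (-α)‖) * M + M ^ 2) +
        W / c * (A ^ 2 * ((c : ℝ) + C') * (|α| * (‖𝓕 g₁ α‖ * ‖𝓕 (fun x ↦ conj (g₂ x)) α‖))) +
        W / c * (A ^ 2 * ((c : ℝ) + C') *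
          (|(-α)| * (‖𝓕 g₁ (-α)‖ * ‖𝓕 (fun x ↦ conj (g₂ x)) (-α)‖))) :=
        add_le_add (add_le_add (add_le_add hplus hminus) h3) h4
    _ = _ := by
        field_simp
        ring

/-! ### Integration over `α ∈ (0, 1/(c(C'+1))]` and the leading term -/

/-- `α ↦ e(f(α))` is continuous for continuous `f`. [folklore] -/
private theorem continuous_fourierChar_comp' {f : ℝ → ℝ} (hf : Continuous f) :
    Continuous fun α : ℝ ↦ (𝐞 (f α) : ℂ) := by
  have : (fun α : ℝ ↦ (𝐞 (f α) : ℂ)) =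
      fun α ↦ Complex.exp (((2 * Real.pi * f α : ℝ) : ℂ) * Complex.I) := by
    funext α; exact Real.fourierChar_apply (f α)
  rw [this]
  fun_prop

/-- The trigonometric polynomial `F(θ) = e(−hθ)S₁(θ)S̄₂(θ)` is continuous. [folklore] -/
private theorem continuous_F {X : ℝ} {lam : ℕ → ℂ} {g₁ g₂ : ℝ → ℂ} (h : ℕ) (F : ℝ → ℂ)
    (hF : ∀ θ : ℝ, F θ = (𝐞 (-(h * θ)) : ℂ) *
        ((∑ n ∈ Finset.Icc 1 ⌊2 * X⌋₊, lam n * g₁ n * (𝐞 (n * θ) : ℂ)) *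
          conj (∑ n ∈ Finset.Icc 1 ⌊2 * X⌋₊, lam n * conj (g₂ n) * (𝐞 (n * θ) : ℂ)))) :
    Continuous F := by
  have hF' : F = fun θ ↦ (𝐞 (-(h * θ)) : ℂ) *
      ((∑ n ∈ Finset.Icc 1 ⌊2 * X⌋₊, lam n * g₁ n * (𝐞 (n * θ) : ℂ)) *
        conj (∑ n ∈ Finset.Icc 1 ⌊2 * X⌋₊, lam n * conj (g₂ n) * (𝐞 (n * θ) : ℂ))) := funext hF
  rw [hF']
  refine (continuous_fourierChar_comp' (by fun_prop)).mul ((continuous_finsetSum _ fun n _ ↦ ?_).mul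
    (Complex.continuous_conj.comp (continuous_finsetSum _ fun n _ ↦ ?_)))
  · exact continuous_const.mul (continuous_fourierChar_comp' (by fun_prop))
  · exact continuous_const.mul (continuous_fourierChar_comp' (by fun_prop))

/-- `∫₀^T (f(α) + f(−α)) dα ≤ ∫_ℝ f` for `f ≥ 0` integrable and continuous, `T ≥ 0`. [folklore] -/
private theorem integral_add_reflect_le {f : ℝ → ℝ} (hf : Integrable f) (hfc : Continuous f)
    (hf0 : ∀ α, 0 ≤ f α) {T : ℝ} (hT : 0 ≤ T) :
    ∫ α in (0 : ℝ)..T, (f α + f (-α)) ≤ ∫ α, f α := by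
  have hi : IntervalIntegrable (fun α ↦ f (-α)) volume (0 : ℝ) T :=
    (hfc.comp continuous_neg).intervalIntegrable _ _
  rw [intervalIntegral.integral_add (hfc.intervalIntegrable _ _) hi,
    intervalIntegral.integral_comp_neg, neg_zero,
    add_comm, intervalIntegral.integral_add_adjacent_intervals (hfc.intervalIntegrable _ _)
    (hfc.intervalIntegrable _ _), intervalIntegral.integral_of_le (by linarith)]
  exact setIntegral_le_integral hf (Filter.Eventually.of_forall hf0)

/-- An algebraic identity for the tail term. [folklore] -/
private theorem tail_const_eq (A c₁ I₃ g c C₁ : ℝ) (hc : c ≠ 0) (hC : C₁ ≠ 0) :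
    (A / c) ^ 2 * g * (c₁ ^ 2 * I₃ / (1 / (c * C₁))) = A ^ 2 * (c₁ ^ 2 * I₃) * C₁ * g / c := by
  field_simp

set_option maxHeartbeats 400000 in
/-- **The contribution of the modulus `c` against its leading term.** For `1 ≤ c ≤ C' = ⌊C⌋`,
`C = 2√(qX) ≤ C' + 1`, test functions `g₁, g₂` of (4.18) on `[X, 2X]`, `h ≥ 0`, and
`F(θ) = e(−hθ)S₁(θ)S̄₂(θ)`:
`‖Σ_{C' < d ≤ c + C', (c,d)=1} ∫₀^{1/cd}(F(a_d/c − α) + F(−(a_d/c − α)))dα − p(c)²r_c(h)∫g₁(x+h)g₂(x)dx‖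
 ≤ (W_c/c)(2AMc₁I₂ + 2M²/(C'+1) + A²(c + C')c₁²I₃) + A²c₁²I₃(C'+1)(h,c)/c` — the rearrangement
(4.11)–(4.13), the pointwise estimate integrated with (4.8)–(4.9), the extension of the `α`-integral
to `ℝ` ("at the cost of an error term which is already present") and Plancherel.
[cite: ConreyIwaniec2002, §4, proof of Theorem 4.1 ((4.11)–(4.17))] -/
theorem norm_modulus_sub_main_le
    {A B K₀ c₁ : ℝ} {q : ℕ} {lam : ℕ → ℂ} {kf : ℕ → ℕ → ℝ → ℂ} {p : ℕ → ℝ} {u : ℕ → ℤ → ℂ}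
    {φ : ℕ → ℕ → ℂ} {l : ℕ → ℕ → ℤ}
    (hV : IsVoronoiDatum A lam kf p u φ l) (hK : KernelFourierBound q B kf)
    (hKl : IncompleteKloostermanBound K₀) (hK₀ : 0 ≤ K₀) (hFd : BumpFourierDecay c₁) (hc₁ : 0 < c₁)
    {X : ℝ} (hX : 1 / 2 ≤ X) {g₁ g₂ : ℝ → ℂ} (hg₁ : IsBumpOn X g₁) (hg₂ : IsBumpOn X g₂)
    (h : ℕ) {C' c : ℕ} (hc : 1 ≤ c) (hcC' : c ≤ C') (hC'C : (C' : ℝ) ≤ 2 * Real.sqrt (q * X))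
    (hCC' : 2 * Real.sqrt (q * X) ≤ C' + 1)
    (F : ℝ → ℂ)
    (hF : ∀ θ : ℝ, F θ = (𝐞 (-(h * θ)) : ℂ) *
        ((∑ n ∈ Finset.Icc 1 ⌊2 * X⌋₊, lam n * g₁ n * (𝐞 (n * θ) : ℂ)) *
          conj (∑ n ∈ Finset.Icc 1 ⌊2 * X⌋₊, lam n * conj (g₂ n) * (𝐞 (n * θ) : ℂ)))) :
    ‖(∑ d ∈ (Finset.Ioc C' (c + C')).filter (fun d ↦ Nat.Coprime c d),
        ∫ α in (0 : ℝ)..(1 / ((c : ℝ) * d)),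
          (F (((((d : ZMod c)⁻¹).val : ℝ)) / c - α) + F (-(((((d : ZMod c)⁻¹).val : ℝ)) / c - α)))) -
      (p c : ℂ) ^ 2 * ramanujanSum c h * ∫ x : ℝ, g₁ (x + h) * g₂ x‖ ≤
      (K₀ * (Nat.divisors c).card * Real.sqrt (Nat.gcd h c) * Real.sqrt c * (1 + Real.log c)) / c *
        (A * (A * B * (2 * Real.sqrt (q * X)) * (∑' n : ℕ, (n : ℝ) ^ (-(5 / 4 : ℝ))) ^ 2) *
            (2 * (c₁ * ∫ u : ℝ, ((1 + |u|) ^ 2)⁻¹)) +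
          2 * (A * B * (2 * Real.sqrt (q * X)) * (∑' n : ℕ, (n : ℝ) ^ (-(5 / 4 : ℝ))) ^ 2) ^ 2 /
            ((C' : ℝ) + 1) +
          A ^ 2 * ((c : ℝ) + C') * (c₁ ^ 2 * ∫ u : ℝ, ((1 + |u|) ^ 3)⁻¹)) +
      A ^ 2 * (c₁ ^ 2 * ∫ u : ℝ, ((1 + |u|) ^ 3)⁻¹) * ((C' : ℝ) + 1) * (Nat.gcd h c : ℝ) / c := by
  classical
  -- abbreviations
  set C : ℝ := 2 * Real.sqrt (q * X) with hCdef
  set M : ℝ := A * B * C * (∑' n : ℕ, (n : ℝ) ^ (-(5 / 4 : ℝ))) ^ 2 with hM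
  set W : ℝ := K₀ * (Nat.divisors c).card * Real.sqrt (Nat.gcd h c) * Real.sqrt c *
    (1 + Real.log c) with hW
  set I₂ : ℝ := ∫ u : ℝ, ((1 + |u|) ^ 2)⁻¹ with hI₂
  set I₃ : ℝ := ∫ u : ℝ, ((1 + |u|) ^ 3)⁻¹ with hI₃
  set D : Finset ℕ := (Finset.Ioc C' (c + C')).filter (fun d ↦ Nat.Coprime c d) with hD
  set T : ℝ := 1 / ((c : ℝ) * (C' + 1)) with hT
  set g₂c : ℝ → ℂ := fun x ↦ conj (g₂ x) with hg₂c
  have hg₂' : IsBumpOn X g₂c := isBumpOn_conj hg₂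
  set G : ℝ → ℂ := fun β ↦ 𝓕 g₁ β * conj (𝓕 g₂c β) with hG
  set n₁ : ℝ → ℝ := fun β ↦ ‖𝓕 g₁ β‖ with hn₁
  set n₂ : ℝ → ℝ := fun β ↦ ‖𝓕 g₂c β‖ with hn₂
  set Gd : ℕ → ℝ → ℂ := fun d α ↦
    F (((((d : ZMod c)⁻¹).val : ℝ)) / c - α) + F (-(((((d : ZMod c)⁻¹).val : ℝ)) / c - α)) with hGd
  set r : ℂ := ramanujanSum c h with hr
  set P2 : ℂ := (p c : ℂ) ^ 2 with hP2
  have hc' : (0 : ℝ) < c := by exact_mod_cast hc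
  have hT0 : 0 < T := by positivity
  have hX0 : 0 < X := by linarith
  obtain ⟨hp0, hpA, -, -⟩ := hV c hc
  have hA0 : 0 ≤ A := by
    have := hp0.trans hpA
    rw [le_div_iff₀ hc'] at this
    nlinarith
  have hCpos : 0 < C := lt_of_lt_of_le hc' (le_trans (by exact_mod_cast hcC') hC'C)
  have hcC : (c : ℝ) ≤ C := le_trans (by exact_mod_cast hcC') hC'C
  have hM0 : 0 ≤ M := le_trans (tsum_nonneg fun _ ↦ norm_nonneg _)
    (summable_norm_coeff_mul_fourier hV hK hX hg₁ hc hcC (α := 0) (by rw [abs_zero]; positivity)).2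
  have hW0 : 0 ≤ W := by rw [hW]; positivity
  have hFc : Continuous F := continuous_F h F hF
  have hGdc : ∀ d, Continuous (Gd d) := fun d ↦
    (hFc.comp (continuous_const.sub continuous_id)).add
      (hFc.comp (continuous_const.sub continuous_id).neg)
  -- Step 1: the rearrangement (4.11)–(4.13)
  have hDge : ∀ d ∈ D, C' + 1 ≤ d := fun d hd ↦ by
    rw [hD, Finset.mem_filter, Finset.mem_Ioc] at hd; omega
  have hstep1 : ∑ d ∈ D, ∫ α in (0 : ℝ)..(1 / ((c : ℝ) * d)), Gd d α =
      ∫ α in (0 : ℝ)..T, ∑ d ∈ D.filter (fun d : ℕ ↦ α ≤ 1 / ((c : ℝ) * (d : ℝ))), Gd d α :=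
    sum_intervalIntegral_eq_integral_sum_filter hc D hDge Gd fun d _ ↦ (hGdc d).intervalIntegrable _ _
  set V : ℝ → ℂ := fun α ↦ ∑ d ∈ D.filter (fun d : ℕ ↦ α ≤ 1 / ((c : ℝ) * (d : ℝ))), Gd d α with hVdef
  have hVint : IntervalIntegrable V volume 0 T := by
    have hVeq : V = ∑ d ∈ D, Set.indicator {α : ℝ | α ≤ 1 / ((c : ℝ) * (d : ℝ))} (Gd d) := by
      funext α
      simp only [hVdef, Finset.sum_apply]
      rw [Finset.sum_filter]
      refine Finset.sum_congr rfl fun d _ ↦ ?_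
      by_cases hα : α ≤ 1 / ((c : ℝ) * (d : ℝ))
      · rw [if_pos hα, Set.indicator_of_mem (by exact hα)]
      · rw [if_neg hα, Set.indicator_of_notMem (by exact hα)]
    rw [hVeq]
    exact IntervalIntegrable.sum D fun d _ ↦
      ⟨((hGdc d).intervalIntegrable 0 T).1.indicator measurableSet_Iic,
        ((hGdc d).intervalIntegrable 0 T).2.indicator measurableSet_Iic⟩
  -- Step 2: the leading-term function and its integral
  set K : ℝ → ℂ := fun α ↦ G α * (𝐞 (h * α) : ℂ) with hKdef
  set Mn : ℝ → ℂ := fun α ↦ P2 * r * (G α * (𝐞 (h * α) : ℂ) + G (-α) * (𝐞 (-(h * α)) : ℂ))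
    with hMndef
  have hGc : Continuous G :=
    (continuous_fourier_bump hg₁).mul (Complex.continuous_conj.comp (continuous_fourier_bump hg₂'))
  have hKc : Continuous K := hGc.mul (continuous_fourierChar_comp' (by fun_prop))
  have hKneg : ∀ α : ℝ, K (-α) = G (-α) * (𝐞 (-(h * α)) : ℂ) := fun α ↦ by
    simp only [hKdef, mul_neg]
  have hMnK : Mn = fun α ↦ P2 * r * (K α + K (-α)) := by
    funext α; rw [hMndef, hKneg]
  have hMnc : Continuous Mn := by
    rw [hMnK]; exact continuous_const.mul (hKc.add (hKc.comp continuous_neg))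
  have hMn_int : ∫ α in (0 : ℝ)..T, Mn α = P2 * r * ∫ α in (-T)..T, K α := by
    have hi : IntervalIntegrable (fun α ↦ K (-α)) volume (0 : ℝ) T :=
      (hKc.comp continuous_neg).intervalIntegrable _ _
    rw [hMnK]
    simp only
    rw [intervalIntegral.integral_const_mul, intervalIntegral.integral_add (hKc.intervalIntegrable _ _)
      hi, intervalIntegral.integral_comp_neg, neg_zero,
      add_comm, intervalIntegral.integral_add_adjacent_intervals (hKc.intervalIntegrable _ _)
      (hKc.intervalIntegrable _ _)]
  -- Step 3: the pointwise estimate, integrated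
  set bnd : ℝ → ℝ := fun α ↦ W / c * (A * M * (n₁ α + n₂ α + (n₁ (-α) + n₂ (-α))) +
      2 * c * M ^ 2 + A ^ 2 * ((c : ℝ) + C') *
        (|α| * (n₁ α * n₂ α) + |(-α)| * (n₁ (-α) * n₂ (-α)))) with hbnd
  have hptw : ∀ α ∈ Set.Ioc (0 : ℝ) T, ‖V α - Mn α‖ ≤ bnd α := fun α hα ↦
    norm_pointwise_sub_main_le hV hK hKl hK₀ hX hg₁ hg₂ h hc hcC' hC'C hCC' hα.1 hα.2 F hF
  have hn₁c : Continuous n₁ := (continuous_fourier_bump hg₁).norm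
  have hn₂c : Continuous n₂ := (continuous_fourier_bump hg₂').norm
  have hbndc : Continuous bnd := by
    rw [hbnd]
    fun_prop
  have h3 : ‖(∫ α in (0 : ℝ)..T, V α) - ∫ α in (0 : ℝ)..T, Mn α‖ ≤ ∫ α in (0 : ℝ)..T, bnd α := by
    rw [← intervalIntegral.integral_sub hVint (hMnc.intervalIntegrable _ _)]
    exact intervalIntegral.norm_integral_le_of_norm_le hT0.le
      (Filter.Eventually.of_forall fun α hα ↦ hptw α hα) (hbndc.intervalIntegrable _ _)
  -- Step 4: `∫₀^T bnd ≤ (W/c)(2AMc₁I₂ + 2M²/(C'+1) + A²(c+C')c₁²I₃)` by (4.8)–(4.9)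
  have hn₁i : Integrable n₁ := (integrable_fourier_bump hFd hX hg₁).norm
  have hn₂i : Integrable n₂ := (integrable_fourier_bump hFd hX hg₂').norm
  have hn₁le : ∫ α, n₁ α ≤ c₁ * I₂ := integral_norm_fourier_le hFd hX hg₁
  have hn₂le : ∫ α, n₂ α ≤ c₁ * I₂ := integral_norm_fourier_le hFd hX hg₂'
  have hPi : Integrable (fun α ↦ |α| * (n₁ α * n₂ α)) :=
    integrable_abs_mul_norm_fourier_mul hFd hc₁ hX hg₁ hg₂'
  have hPc : Continuous (fun α : ℝ ↦ |α| * (n₁ α * n₂ α)) := by fun_prop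
  have hPle : ∫ α, |α| * (n₁ α * n₂ α) ≤ c₁ ^ 2 * I₃ :=
    integral_abs_mul_norm_fourier_mul_le hFd hc₁ hX hg₁ hg₂'
  have hI1 : ∫ α in (0 : ℝ)..T, (n₁ α + n₂ α + (n₁ (-α) + n₂ (-α))) ≤ c₁ * I₂ + c₁ * I₂ := by
    have e : (fun α ↦ n₁ α + n₂ α + (n₁ (-α) + n₂ (-α))) =
        fun α ↦ (n₁ α + n₁ (-α)) + (n₂ α + n₂ (-α)) := by funext α; ring
    have hi1 : IntervalIntegrable (fun α ↦ n₁ α + n₁ (-α)) volume (0 : ℝ) T :=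
      (hn₁c.add (hn₁c.comp continuous_neg)).intervalIntegrable _ _
    have hi2 : IntervalIntegrable (fun α ↦ n₂ α + n₂ (-α)) volume (0 : ℝ) T :=
      (hn₂c.add (hn₂c.comp continuous_neg)).intervalIntegrable _ _
    rw [e, intervalIntegral.integral_add hi1 hi2]
    exact add_le_add
      ((integral_add_reflect_le hn₁i hn₁c (fun _ ↦ norm_nonneg _) hT0.le).trans hn₁le)
      ((integral_add_reflect_le hn₂i hn₂c (fun _ ↦ norm_nonneg _) hT0.le).trans hn₂le)
  have hI3 : ∫ α in (0 : ℝ)..T, (|α| * (n₁ α * n₂ α) + |(-α)| * (n₁ (-α) * n₂ (-α))) ≤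
      c₁ ^ 2 * I₃ :=
    (integral_add_reflect_le hPi hPc (fun _ ↦ by positivity) hT0.le).trans hPle
  have h4 : ∫ α in (0 : ℝ)..T, bnd α ≤ W / c * (A * M * (2 * (c₁ * I₂)) +
      2 * M ^ 2 / ((C' : ℝ) + 1) + A ^ 2 * ((c : ℝ) + C') * (c₁ ^ 2 * I₃)) := by
    set Sf : ℝ → ℝ := fun α ↦ n₁ α + n₂ α + (n₁ (-α) + n₂ (-α)) with hSf
    set Pf : ℝ → ℝ := fun α ↦ |α| * (n₁ α * n₂ α) + |(-α)| * (n₁ (-α) * n₂ (-α)) with hPf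
    have hSc : Continuous Sf := by rw [hSf]; fun_prop
    have hPc' : Continuous Pf := by rw [hPf]; fun_prop
    have hbnd' : bnd = fun α ↦ (W / c * (A * M)) * Sf α + W / c * (2 * c * M ^ 2) +
        (W / c * (A ^ 2 * ((c : ℝ) + C'))) * Pf α := by
      funext α; simp only [hbnd, hSf, hPf]; ring
    have hi1 : IntervalIntegrable (fun α ↦ (W / c * (A * M)) * Sf α) volume (0 : ℝ) T :=
      (continuous_const.mul hSc).intervalIntegrable _ _
    have hi2 : IntervalIntegrable (fun _ : ℝ ↦ W / c * (2 * c * M ^ 2)) volume (0 : ℝ) T :=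
      intervalIntegrable_const
    have hi3 : IntervalIntegrable (fun α ↦ (W / c * (A ^ 2 * ((c : ℝ) + C'))) * Pf α) volume
        (0 : ℝ) T := (continuous_const.mul hPc').intervalIntegrable _ _
    have hI2 : ∫ _ in (0 : ℝ)..T, W / c * (2 * c * M ^ 2) = W / c * (2 * M ^ 2 / ((C' : ℝ) + 1)) := by
      rw [intervalIntegral.integral_const, sub_zero, smul_eq_mul, hT]
      field_simp
    rw [hbnd', intervalIntegral.integral_add (hi1.add hi2) hi3, intervalIntegral.integral_add hi1 hi2,
      intervalIntegral.integral_const_mul (W / c * (A * M)) Sf,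
      intervalIntegral.integral_const_mul (W / c * (A ^ 2 * ((c : ℝ) + C'))) Pf, hI2]
    have hI1' : ∫ α in (0 : ℝ)..T, Sf α ≤ 2 * (c₁ * I₂) := by rw [hSf]; linarith [hI1]
    have hI3' : ∫ α in (0 : ℝ)..T, Pf α ≤ c₁ ^ 2 * I₃ := by rw [hPf]; exact hI3
    have hWc : 0 ≤ W / c := by positivity
    have e1 : W / c * (A * M) * ∫ α in (0 : ℝ)..T, Sf α ≤ W / c * (A * M) * (2 * (c₁ * I₂)) :=
      mul_le_mul_of_nonneg_left hI1' (mul_nonneg hWc (mul_nonneg hA0 hM0))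
    have e3 : W / c * (A ^ 2 * ((c : ℝ) + C')) * ∫ α in (0 : ℝ)..T, Pf α ≤
        W / c * (A ^ 2 * ((c : ℝ) + C')) * (c₁ ^ 2 * I₃) :=
      mul_le_mul_of_nonneg_left hI3' (mul_nonneg hWc (by positivity))
    linarith [e1, e3]
  -- Step 5: the leading term — Plancherel and the tail of the `α`-integral
  have hJ : ∫ α, K α = ∫ x, g₁ (x + h) * g₂ x := by
    exact integral_fourier_mul_conj_fourier_conj_mul_fourierChar hFd hX hg₁ hg₂ (h : ℝ)
  have hGi : Integrable G := by
    refine Integrable.mono' (integrable_norm_fourier_mul hFd hc₁ hX hg₁ hg₂') hGc.aestronglyMeasurable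
      (Filter.Eventually.of_forall fun α ↦ ?_)
    rw [hG, norm_mul, Complex.norm_conj]
  have hKi : Integrable K := by
    refine hGi.mul_bdd (c := 1) (continuous_fourierChar_comp' (by fun_prop)).aestronglyMeasurable
      (Filter.Eventually.of_forall fun α ↦ ?_)
    rw [Circle.norm_coe]
  have hKn : ∀ α, ‖K α‖ = n₁ α * n₂ α := fun α ↦ by
    rw [hKdef]; simp only; rw [norm_mul, Circle.norm_coe, mul_one, hG]; simp only
    rw [norm_mul, Complex.norm_conj]
  have htail : ‖(∫ α in (-T)..T, K α) - ∫ α, K α‖ ≤ c₁ ^ 2 * I₃ / T := by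
    rw [intervalIntegral.integral_of_le (by linarith),
      ← integral_add_compl (measurableSet_Ioc : MeasurableSet (Set.Ioc (-T) T)) hKi,
      sub_add_cancel_left, norm_neg]
    have hS : MeasurableSet (Set.Ioc (-T) T)ᶜ := measurableSet_Ioc.compl
    calc ‖∫ α in (Set.Ioc (-T) T)ᶜ, K α‖ ≤ ∫ α in (Set.Ioc (-T) T)ᶜ, ‖K α‖ :=
          norm_integral_le_integral_norm _
      _ ≤ ∫ α in (Set.Ioc (-T) T)ᶜ, T⁻¹ * (|α| * (n₁ α * n₂ α)) := by
          refine setIntegral_mono_on hKi.norm.integrableOn (hPi.const_mul _).integrableOn hS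
            fun α hα ↦ ?_
          rw [hKn]
          have hαT : T ≤ |α| := by
            simp only [Set.mem_compl_iff, Set.mem_Ioc, not_and_or, not_lt, not_le] at hα
            rcases hα with hα | hα
            · rw [abs_of_nonpos (by linarith)]; linarith
            · rw [abs_of_pos (by linarith)]; linarith
          have hP0 : 0 ≤ n₁ α * n₂ α := mul_nonneg (norm_nonneg _) (norm_nonneg _)
          calc n₁ α * n₂ α = T⁻¹ * (T * (n₁ α * n₂ α)) := by field_simp
            _ ≤ T⁻¹ * (|α| * (n₁ α * n₂ α)) := by gcongr
      _ = T⁻¹ * ∫ α in (Set.Ioc (-T) T)ᶜ, |α| * (n₁ α * n₂ α) := integral_const_mul _ _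
      _ ≤ T⁻¹ * ∫ α, |α| * (n₁ α * n₂ α) :=
          mul_le_mul_of_nonneg_left
            (setIntegral_le_integral hPi (Filter.Eventually.of_forall fun _ ↦ by positivity))
            (by positivity)
      _ ≤ T⁻¹ * (c₁ ^ 2 * I₃) := by gcongr
      _ = c₁ ^ 2 * I₃ / T := by ring
  -- Step 6: assembly
  have hP2n : ‖P2‖ = p c ^ 2 := by
    rw [hP2, norm_pow, Complex.norm_real, Real.norm_of_nonneg hp0]
  have hrn : ‖r‖ ≤ (Nat.gcd h c : ℝ) := by
    have := norm_ramanujanSum_le_gcd c (h : ℤ)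
    rw [int_gcd_natCast] at this
    exact this
  have hp2 : p c ^ 2 ≤ (A / c) ^ 2 := pow_le_pow_left₀ hp0 hpA 2
  have h6 : ‖(∫ α in (0 : ℝ)..T, Mn α) - P2 * r * ∫ x : ℝ, g₁ (x + h) * g₂ x‖ ≤
      A ^ 2 * (c₁ ^ 2 * I₃) * ((C' : ℝ) + 1) * (Nat.gcd h c : ℝ) / c := by
    rw [hMn_int, ← hJ, ← mul_sub, norm_mul, norm_mul, hP2n]
    calc p c ^ 2 * ‖r‖ * ‖(∫ α in (-T)..T, K α) - ∫ α, K α‖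
        ≤ (A / c) ^ 2 * (Nat.gcd h c : ℝ) * (c₁ ^ 2 * I₃ / T) :=
          mul_le_mul (mul_le_mul hp2 hrn (norm_nonneg _) (by positivity)) htail (norm_nonneg _)
            (by positivity)
      _ = A ^ 2 * (c₁ ^ 2 * I₃) * ((C' : ℝ) + 1) * (Nat.gcd h c : ℝ) / c := by
          rw [hT]; exact tail_const_eq A c₁ I₃ _ c _ hc'.ne' (by positivity)
  calc ‖(∑ d ∈ D, ∫ α in (0 : ℝ)..(1 / ((c : ℝ) * d)), Gd d α) -
        P2 * r * ∫ x : ℝ, g₁ (x + h) * g₂ x‖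
      = ‖(∫ α in (0 : ℝ)..T, V α) - P2 * r * ∫ x : ℝ, g₁ (x + h) * g₂ x‖ := by rw [hstep1]
    _ ≤ ‖(∫ α in (0 : ℝ)..T, V α) - ∫ α in (0 : ℝ)..T, Mn α‖ +
        ‖(∫ α in (0 : ℝ)..T, Mn α) - P2 * r * ∫ x : ℝ, g₁ (x + h) * g₂ x‖ :=
        norm_sub_le_norm_sub_add_norm_sub _ _ _
    _ ≤ _ := add_le_add (h3.trans h4) h6

end CircleMethod

end ConreyIwaniec2002

end Literature.NumberTheory.LFunctions

end
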